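import Mathlib
import Summits.ValiantsHypothesis.ValiantsHypothesis.Theorems.ElementaryWordLengthWordPerSuperQuarticStubChainResolvent

/-!
# Chain determinant form: the principal-minor form of a chain entry (`stub_chainDetForm`)

By the chain resolvent (`stub_chainResolvent`) a chain of rank-one factors satisfies
`Π_{t<m} (1 + x_{v_t} u_t w_tᵀ) = 1 + Uᵀ D S W` with `U = (u_t(i))`, `W = (w_t(j))`,
`D = diag (x_{v_t})`, the strictly upper triangular transfer matrix
`G_{st} = [s < t] (w_s ⬝ᵥ u_t)` and `S = Σ_{d<m} (G D)^d`.  Here we rewrite the `(i, j)` entry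
`(Uᵀ D S W)_{ij} = aᵀ D S b` (`a` = column `i` of `U`, `b` = column `j` of `W`) as a determinant:
`det (1 + D K) = 1 + aᵀ D S b` for `K = b aᵀ - G`.

Proof: `1 + D K = E + D b aᵀ` with the unipotent upper triangular `E = 1 - D G`; the Neumann
series `S' = Σ_{d<m} (D G)^d` satisfies `E S' = 1` (as `(D G)^m = 0`), so
`1 + D K = E (1 + S' D b aᵀ)` and `det (1 + D K) = det E · (1 + aᵀ S' D b) = 1 + aᵀ D S b` by the
matrix determinant lemma, `det E = 1` and the push-through identity `S' D = D S`.
-/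

set_option linter.dupNamespace false

namespace Summit.ValiantsHypothesis.ValiantsHypothesis.Theorems.WordPerSuperQuartic

open Matrix

variable {R : Type*} [CommRing R]

/-- Entries of powers of a strictly upper triangular matrix: `(M ^ d) s t = 0` unless
`s + d ≤ t`. -/
private theorem chainDetForm_pow_apply {m : ℕ} (M : Matrix (Fin m) (Fin m) R)
    (hM : ∀ s t : Fin m, (t : ℕ) ≤ s → M s t = 0) :
    ∀ (d : ℕ) (s t : Fin m), (t : ℕ) < s + d → (M ^ d) s t = 0 := by
  intro d
  induction d with
  | zero =>
    intro s t hst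
    rw [pow_zero, Matrix.one_apply_ne]
    intro h
    subst h
    omega
  | succ d ih =>
    intro s t hst
    rw [pow_succ, Matrix.mul_apply]
    refine Finset.sum_eq_zero (fun r _ => ?_)
    by_cases hrt : (t : ℕ) ≤ r
    · rw [hM r t hrt, mul_zero]
    · rw [ih s r (by omega), zero_mul]

/-- A strictly upper triangular `m × m` matrix `M` satisfies `M ^ m = 0`. -/
private theorem chainDetForm_pow_eq_zero {m : ℕ} (M : Matrix (Fin m) (Fin m) R)
    (hM : ∀ s t : Fin m, (t : ℕ) ≤ s → M s t = 0) : M ^ m = 0 := by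
  ext s t
  exact chainDetForm_pow_apply M hM m s t (by have := t.is_lt; omega)

/-- Neumann series: for a strictly upper triangular `m × m` matrix `M` the truncated geometric
series `Σ_{d<m} M^d` is a right inverse of `1 - M`. -/
private theorem chainDetForm_neumann {m : ℕ} (M : Matrix (Fin m) (Fin m) R)
    (hM : ∀ s t : Fin m, (t : ℕ) ≤ s → M s t = 0) :
    (1 - M) * (∑ d ∈ Finset.range m, M ^ d) = 1 := by
  rw [mul_neg_geom_sum, chainDetForm_pow_eq_zero M hM, sub_zero]

/-- A unipotent upper triangular matrix has determinant `1`: `det (1 - M) = 1` for strictly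
upper triangular `M`. -/
private theorem chainDetForm_det_one_sub {m : ℕ} (M : Matrix (Fin m) (Fin m) R)
    (hM : ∀ s t : Fin m, (t : ℕ) ≤ s → M s t = 0) :
    Matrix.det (1 - M) = 1 := by
  have h : (1 - M).BlockTriangular id := by
    intro s t hts
    have hts' : t < s := hts
    rw [Matrix.sub_apply, Matrix.one_apply_ne (ne_of_gt hts'), hM s t (le_of_lt hts'), sub_zero]
  rw [Matrix.det_of_upperTriangular h]
  refine Finset.prod_eq_one (fun s _ => ?_)
  rw [Matrix.sub_apply, Matrix.one_apply_eq, hM s s le_rfl, sub_zero]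

/-- Push-through identity: `(Σ_{d<m} (D G)^d) D = D Σ_{d<m} (G D)^d`. -/
private theorem chainDetForm_push {n : Type*} [Fintype n] [DecidableEq n]
    (D G : Matrix n n R) (m : ℕ) :
    (∑ d ∈ Finset.range m, (D * G) ^ d) * D = D * ∑ d ∈ Finset.range m, (G * D) ^ d := by
  rw [Finset.sum_mul, Finset.mul_sum]
  refine Finset.sum_congr rfl (fun d _ => ?_)
  have h : SemiconjBy D (G * D) (D * G) := by
    change D * (G * D) = D * G * D
    rw [Matrix.mul_assoc]
  exact (h.pow_right d).eq.symm

/-- The determinant form over an arbitrary commutative ring: for `D = diag x`, a strictly upper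
triangular `G` and `K = b aᵀ - G`, `det (1 + D K) = 1 + aᵀ D (Σ_{d<m} (G D)^d) b`. -/
private theorem chainDetForm_aux {m : ℕ} (x a b : Fin m → R) (G K : Matrix (Fin m) (Fin m) R)
    (hG : ∀ s t : Fin m, (t : ℕ) ≤ s → G s t = 0)
    (hK : ∀ s t, K s t = b s * a t - G s t) :
    Matrix.det (1 + Matrix.diagonal x * K) =
      1 + a ⬝ᵥ
        ((Matrix.diagonal x * ∑ d ∈ Finset.range m, (G * Matrix.diagonal x) ^ d) *ᵥ b) := by
  have hN : ∀ s t : Fin m, (t : ℕ) ≤ s → (Matrix.diagonal x * G) s t = 0 := by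
    intro s t hts
    rw [Matrix.diagonal_mul, hG s t hts, mul_zero]
  have hKeq : K = Matrix.replicateCol Unit b * Matrix.replicateRow Unit a - G := by
    rw [← Matrix.vecMulVec_eq Unit]
    ext s t
    rw [Matrix.sub_apply, Matrix.vecMulVec_apply, hK]
  have hE := chainDetForm_neumann (Matrix.diagonal x * G) hN
  have hfac : 1 + Matrix.diagonal x * K =
      (1 - Matrix.diagonal x * G) *
        (1 + (∑ d ∈ Finset.range m, (Matrix.diagonal x * G) ^ d) * Matrix.diagonal x *
          Matrix.replicateCol Unit b * Matrix.replicateRow Unit a) := by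
    rw [Matrix.mul_add, Matrix.mul_one, Matrix.mul_assoc _ (Matrix.diagonal x),
      Matrix.mul_assoc (∑ d ∈ Finset.range m, (Matrix.diagonal x * G) ^ d),
      ← Matrix.mul_assoc (1 - Matrix.diagonal x * G), hE, Matrix.one_mul, hKeq, Matrix.mul_sub,
      Matrix.mul_assoc]
    abel
  rw [hfac, Matrix.det_mul, chainDetForm_det_one_sub _ hN, one_mul, chainDetForm_push,
    ← Matrix.replicateCol_mulVec, Matrix.det_one_add_replicateCol_mul_replicateRow]

/-- Entry `(i, j)` of a sandwich `Uᵀ X W` as a bilinear pairing of column `i` of `U` with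
column `j` of `W`. -/
private theorem chainDetForm_entry {n p q : Type*} [Fintype n] (U : Matrix n p R)
    (X : Matrix n n R) (W : Matrix n q R) (i : p) (j : q) :
    (Uᵀ * X * W) i j = (fun t => U t i) ⬝ᵥ (X *ᵥ fun s => W s j) := by
  simp only [Matrix.mul_apply, Matrix.transpose_apply, dotProduct, Matrix.mulVec,
    Finset.sum_mul, Finset.mul_sum, mul_assoc]
  rw [Finset.sum_comm]

/-- R6 — **chain determinant form**: the `(i, j)` entry of `Π_{t<m} (1 + x_{v_t} u_t w_tᵀ) - 1`
is `det (1 + D K) - 1` for the diagonal `D = diag (x_{v_t})` and the matrix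
`K_{st} = w_s(j) u_t(i) - [s < t] (w_s ⬝ᵥ u_t)`. -/
theorem stub_chainDetForm {σ : Type} [DecidableEq σ] (m : ℕ) (v : Fin m → σ)
    (u w : Fin m → Fin 3 → ℂ) (i j : Fin 3) :
    Matrix.det ((1 : Matrix (Fin m) (Fin m) (MvPolynomial σ ℂ)) +
        Matrix.diagonal (fun t => (MvPolynomial.X (v t) : MvPolynomial σ ℂ)) *
          Matrix.of (fun s t : Fin m =>
            MvPolynomial.C (w s j * u t i) - if s < t then MvPolynomial.C (w s ⬝ᵥ u t) else 0)) =
      1 + (((List.ofFn (fun t : Fin m => (v t, Matrix.vecMulVec (u t) (w t)))).map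
              (fun e => (1 : Matrix (Fin 3) (Fin 3) (MvPolynomial σ ℂ)) +
                (MvPolynomial.X e.1 : MvPolynomial σ ℂ) •
                  e.2.map (MvPolynomial.C : ℂ → MvPolynomial σ ℂ))).prod -
            (1 : Matrix (Fin 3) (Fin 3) (MvPolynomial σ ℂ))) i j := by
  rw [stub_chainResolvent m v u w, add_sub_cancel_left, Matrix.mul_assoc _ (Matrix.diagonal _),
    chainDetForm_entry]
  refine chainDetForm_aux (R := MvPolynomial σ ℂ) (fun t => MvPolynomial.X (v t))
    (fun t => MvPolynomial.C (u t i)) (fun s => MvPolynomial.C (w s j))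
    (Matrix.of (fun s t : Fin m => if s < t then MvPolynomial.C (w s ⬝ᵥ u t) else 0)) _
    (fun s t hts => ?_) (fun s t => ?_)
  · rw [Matrix.of_apply, if_neg (by rw [Fin.lt_def]; omega)]
  · rw [Matrix.of_apply, Matrix.of_apply, map_mul]

end Summit.ValiantsHypothesis.ValiantsHypothesis.Theorems.WordPerSuperQuartic
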